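import Literature.NumberTheory.Transcendental.ZudilinBricks
import HarnessLib

/-!
# Arithmetic of the regularised products `G n i` ([Zudilin2004, (8.10)–(8.11)])

Topic `Literature/NumberTheory/Transcendental`. For `G n i` (`= Rₙ(k)(k+i)^{10}` regularised at
`k = -i`, file `ZudilinBricks.lean`) and a pole index `i ∈ [2n, 35n]` we prove, brick by brick
through the Leibniz rule:

* `Zudilin2004.G_isDInt` — `D_{33n}^j · (1/j!) G^{(j)}(-i) ∈ ℤ` for all `j`
  ([Zudilin2004, (8.10)]: `D_{m₀}^{q-j} B_{jk} ∈ ℤ`, from Lemmas 15, 16);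
* `Zudilin2004.G_isDOrd` — `ord_p G^{(j)}(-i) ≥ -j + ν_{k',p}`, `k' = i + 27n + 1`, for primes
  `p` with `p² > 91n + 2` ([Zudilin2004, (8.11)], from Lemmas 17, 18), with `ν_{k',p}` the landed
  `Zudilin2004.nu` (its integer-division form is the lemma `Zudilin2004.nu_eq_ediv`);
* `Zudilin2004.divDeriv_G_eq_zero` — `(1/a!) G^{(a)}(-i) = 0` for `a < 10 - b(i)`, where
  `b(i) = poleOrderBound n i = #{u : (12-u)n ≤ i ≤ (25+u)n}` is the number of reciprocal bricks with
  a pole at `-i`, an upper bound for the order of the pole of `Rₙ` at `-i` (so the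
  partial-fraction coefficient of `(k+i)^{-s}` vanishes for `s > b(i)`, in particular for
  `i > (36-s)n`, `Zudilin2004.poleOrderBound_lt_of_lt`).

Everything here is PROVED (no named facts).

## References

* [Zudilin2004] W. Zudilin, *Arithmetic of linear forms involving odd zeta values*, J. Théor.
  Nombres Bordeaux 16 (2004), 251–291, §8, proof of Lemma 19, (8.9)–(8.11).
-/

noncomputable section

open Finset Filter Literature.Analysis.Calculus
open scoped Nat

namespace Literature.NumberTheory.Transcendental

namespace Zudilin2004

/-! ### `ν_{k,p}` with integer divisions -/

/-- `⌊q/p⌋ = z/p` when `q = z ∈ ℤ`. [folklore] -/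
theorem floor_div_natCast_eq {q : ℚ} (z : ℤ) (p : ℕ) (h : q = z) : ⌊q / p⌋ = z / (p : ℤ) := by
  rw [h]
  exact Rat.floor_intCast_div_natCast z p

/-- `ν_{k,p}` of [Zudilin2004, (8.9)] (`Zudilin2004.nu`, Theorem 3 parameters) written with integer
divisions `Int.ediv` instead of integer parts of rational quotients. [cite: Zudilin2004, §8 (8.9)] -/
theorem nu_eq_ediv (n k p : ℕ) : nu n k p =
    3 * (((k : ℤ) - 1) / p + ((91 * n + 2 : ℤ) - k - 1) / p - ((k : ℤ) - (27 * n + 1)) / p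
        - ((91 * n + 2 : ℤ) - (27 * n + 1) - k) / p - 2 * (((27 * n : ℤ)) / p)) +
    ∑ j ∈ Icc (4 : ℕ) 13, ((((41 : ℤ) - 2 * j) * n) / p - ((k : ℤ) - ((25 + j) * n + 1)) / p
        - ((91 * n + 2 : ℤ) - ((25 + j) * n + 1) - k) / p) := by
  unfold nu
  rw [floor_div_natCast_eq ((k : ℤ) - 1) p (by push_cast; ring),
    floor_div_natCast_eq ((91 * n + 2 : ℤ) - k - 1) p (by push_cast; ring),
    floor_div_natCast_eq ((k : ℤ) - (27 * n + 1)) p (by push_cast; ring),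
    floor_div_natCast_eq ((91 * n + 2 : ℤ) - (27 * n + 1) - k) p (by push_cast; ring),
    floor_div_natCast_eq ((27 * n : ℤ)) p (by push_cast; ring)]
  congr 1
  refine sum_congr rfl fun j _ => ?_
  rw [floor_div_natCast_eq (((41 : ℤ) - 2 * j) * n) p (by push_cast; ring),
    floor_div_natCast_eq ((k : ℤ) - ((25 + j) * n + 1)) p (by push_cast; ring),
    floor_div_natCast_eq ((91 * n + 2 : ℤ) - ((25 + j) * n + 1) - k) p (by push_cast; ring)]

/-! ### `D_{33n}`-integrality of the divided derivatives of `G` at `-i` -/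

/-- **[Zudilin2004, (8.10)]**: for `i ∈ [2n, 35n]`, `D_{33n}^j · (1/j!) G^{(j)}(-i) ∈ ℤ` for every
`j` (Lemma 15 for the polynomial bricks with `D_{27n} ∣ D_{33n}`, Lemma 16 for the regularised
reciprocal bricks with `a₀ = 2n`, `b₀ = 35n + 1`, and the product rule).
[cite: Zudilin2004, §8 Lemma 19 (8.10)] -/
theorem G_isDInt (n : ℕ) {i : ℕ} (hi : i ∈ Icc (2 * n) (35 * n)) (N : ℕ) :
    IsDInt (Nat.lcmUpto (33 * n)) N (G n i) (-(i : ℚ)) := by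
  have hi' := mem_Icc.1 hi
  set d := Nat.lcmUpto (33 * n) with hd
  have hpt : ((-(i : ℤ) : ℤ) : ℚ) = -(i : ℚ) := by push_cast; ring
  -- the linear factor
  have hlin : IsDInt d N (fun t : ℚ => (37 * n : ℚ) + 2 * t) (-(i : ℚ)) := by
    have h := IsDInt.linear d N 2 (37 * n) (-(i : ℤ))
    rw [hpt] at h
    exact h.congr (Eventually.of_forall fun t => by push_cast; ring)
  -- the polynomial bricks
  have hdvd : Nat.lcmUpto (27 * n) ∣ d := lcmUpto_dvd_lcmUpto (by omega)
  have hP1 : IsDInt d N (polyBrick (-(27 * n : ℕ)) (27 * n)) (-(i : ℚ)) := by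
    have h := (polyBrick_isDInt (-(27 * n : ℕ)) (27 * n) (-(i : ℤ)) N).of_dvd hdvd
    rwa [hpt] at h
  have hP2 : IsDInt d N (polyBrick ((37 * n + 1 : ℕ)) (27 * n)) (-(i : ℚ)) := by
    have h := (polyBrick_isDInt ((37 * n + 1 : ℕ)) (27 * n) (-(i : ℤ)) N).of_dvd hdvd
    rwa [hpt] at h
  -- the regularised reciprocal bricks
  have hQ : ∀ u ∈ Icc 1 10,
      IsDInt d N (recipBrickReg (((12 - u) * n : ℕ)) ((13 + 2 * u) * n + 1) i) (-(i : ℚ)) := by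
    intro u hu
    have hu' := mem_Icc.1 hu
    have h := recipBrickReg_isDInt (a₀ := (2 * n : ℤ)) (b₀ := (35 * n + 1 : ℤ))
      (a := (((12 - u) * n : ℕ) : ℤ)) (m := (13 + 2 * u) * n + 1) (k := (i : ℤ)) (by omega)
      (by exact_mod_cast (Nat.mul_le_mul_right n (by omega : 2 ≤ 12 - u))) (by
        have : ((12 - u) * n + ((13 + 2 * u) * n + 1) : ℕ) = (25 + u) * n + 1 := by
          have h1 : (12 - u) * n + (13 + 2 * u) * n = (25 + u) * n := by
            rw [← add_mul]; congr 1; omega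
          omega
        have h2 : (((12 - u) * n : ℕ) : ℤ) + ((13 + 2 * u) * n + 1 : ℕ) ≤ 35 * n + 1 := by
          rw [← Nat.cast_add, this]; push_cast; nlinarith
        exact_mod_cast h2)
      (by exact_mod_cast hi'.1) (by exact_mod_cast Nat.lt_succ_of_le hi'.2) N
    have e : ((35 * n + 1 : ℤ) - 2 * n - 1).toNat = 33 * n := by omega
    rw [e, ← hd] at h
    have hpt' : (-((i : ℤ) : ℚ)) = -(i : ℚ) := by push_cast; ring
    rwa [hpt'] at h
  have hall := ((hlin.mul (hP1.pow 3)).mul (hP2.pow 3)).mul (IsDInt.prod (Icc 1 10) hQ)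
  exact hall.congr (Eventually.of_forall fun k => by simp only [G])

/-! ### `p`-adic orders of the divided derivatives of `G` at `-i` -/

/-- The exponents of the bricks of `G n i` at `-i` (Lemmas 17, 18) add up to `ν_{k',p}` with
`k' = i + 27n + 1` ([Zudilin2004, (8.9)]): the integer-division identity. [cite: Zudilin2004, §8 (8.9)] -/
theorem nu_eq_brickExponents (n i p : ℕ) (hp : 0 < p) :
    nu n (i + 27 * n + 1) p =
      0 + 3 * ((-((27 * n : ℕ) : ℤ) + (27 * n : ℕ) - 1 - (i : ℤ)) / p
              - (-((27 * n : ℕ) : ℤ) - 1 - (i : ℤ)) / p - ((27 * n : ℕ) : ℤ) / p)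
        + 3 * ((((37 * n + 1 : ℕ) : ℤ) + (27 * n : ℕ) - 1 - (i : ℤ)) / p
              - (((37 * n + 1 : ℕ) : ℤ) - 1 - (i : ℤ)) / p - ((27 * n : ℕ) : ℤ) / p)
        + ∑ u ∈ Icc 1 10, (((((13 + 2 * u) * n + 1 : ℕ) : ℤ) - 1) / p
              - ((i : ℤ) - (((12 - u) * n : ℕ) : ℤ)) / p
              - ((((12 - u) * n : ℕ) : ℤ) + (((13 + 2 * u) * n + 1 : ℕ) : ℤ) - 1 - (i : ℤ)) / p) := by
  have hp0 : (0 : ℤ) < p := by exact_mod_cast hp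
  -- the first polynomial brick: (7.5) twice
  have h1 : (-((27 * n : ℕ) : ℤ) + (27 * n : ℕ) - 1 - (i : ℤ)) / p = -((i : ℤ) / p) - 1 := by
    rw [show (-((27 * n : ℕ) : ℤ) + (27 * n : ℕ) - 1 - (i : ℤ)) = -(i : ℤ) - 1 by ring]
    exact Int.neg_sub_one_ediv_eq _ hp0
  have h2 : (-((27 * n : ℕ) : ℤ) - 1 - (i : ℤ)) / p = -(((i : ℤ) + 27 * n) / p) - 1 := by
    rw [show (-((27 * n : ℕ) : ℤ) - 1 - (i : ℤ)) = -((i : ℤ) + 27 * n) - 1 by push_cast; ring]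
    exact Int.neg_sub_one_ediv_eq _ hp0
  rw [h1, h2]
  -- reindex the sum `j = 14 - u`
  rw [nu_eq_ediv]
  have hsum : ∑ j ∈ Icc (4 : ℕ) 13, ((((41 : ℤ) - 2 * j) * n) / p
        - (((i + 27 * n + 1 : ℕ) : ℤ) - ((25 + j) * n + 1)) / p
        - ((91 * n + 2 : ℤ) - ((25 + j) * n + 1) - ((i + 27 * n + 1 : ℕ) : ℤ)) / p)
      = ∑ u ∈ Icc 1 10, (((((13 + 2 * u) * n + 1 : ℕ) : ℤ) - 1) / p
              - ((i : ℤ) - (((12 - u) * n : ℕ) : ℤ)) / p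
              - ((((12 - u) * n : ℕ) : ℤ) + (((13 + 2 * u) * n + 1 : ℕ) : ℤ) - 1 - (i : ℤ)) / p) := by
    refine sum_nbij' (fun j => 14 - j) (fun u => 14 - u) ?_ ?_ ?_ ?_ ?_
    · intro j hj; have := mem_Icc.1 hj; exact mem_Icc.2 ⟨by omega, by omega⟩
    · intro u hu; have := mem_Icc.1 hu; exact mem_Icc.2 ⟨by omega, by omega⟩
    · intro j hj; have := mem_Icc.1 hj; omega
    · intro u hu; have := mem_Icc.1 hu; omega
    · intro j hj
      have hj' := mem_Icc.1 hj
      have e1 : (((41 : ℤ) - 2 * j) * n) = ((((13 + 2 * (14 - j)) * n + 1 : ℕ) : ℤ) - 1) := by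
        rw [Nat.cast_add, Nat.cast_mul, Nat.cast_add, Nat.cast_mul, Nat.cast_sub (by omega)]
        push_cast; ring
      have e2 : (((i + 27 * n + 1 : ℕ) : ℤ) - ((25 + j) * n + 1))
          = ((i : ℤ) - (((12 - (14 - j)) * n : ℕ) : ℤ)) := by
        rw [Nat.cast_mul, Nat.cast_sub (by omega), Nat.cast_sub (by omega)]
        push_cast; ring
      have e3 : ((91 * n + 2 : ℤ) - ((25 + j) * n + 1) - ((i + 27 * n + 1 : ℕ) : ℤ))
          = ((((12 - (14 - j)) * n : ℕ) : ℤ) + (((13 + 2 * (14 - j)) * n + 1 : ℕ) : ℤ) - 1 - (i : ℤ)) := by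
        rw [Nat.cast_mul, Nat.cast_sub (by omega), Nat.cast_sub (by omega)]
        push_cast
        rw [Nat.cast_sub (by omega)]
        push_cast; ring
      rw [e1, e2, e3]
  rw [hsum]
  -- the first group
  have e4 : (((i + 27 * n + 1 : ℕ) : ℤ) - 1) = (i : ℤ) + 27 * n := by push_cast; ring
  have e5 : ((91 * n + 2 : ℤ) - ((i + 27 * n + 1 : ℕ) : ℤ) - 1)
      = (((37 * n + 1 : ℕ) : ℤ) + (27 * n : ℕ) - 1 - (i : ℤ)) := by push_cast; ring
  have e6 : (((i + 27 * n + 1 : ℕ) : ℤ) - (27 * n + 1)) = (i : ℤ) := by push_cast; ring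
  have e7 : ((91 * n + 2 : ℤ) - (27 * n + 1) - ((i + 27 * n + 1 : ℕ) : ℤ))
      = (((37 * n + 1 : ℕ) : ℤ) - 1 - (i : ℤ)) := by push_cast; ring
  have e8 : ((27 * n : ℤ)) = ((27 * n : ℕ) : ℤ) := by push_cast; ring
  rw [e4, e5, e6, e7, e8]
  ring

/-- **[Zudilin2004, (8.11)]**: for a prime `p` with `p² > 91n + 2` and `i ∈ [2n, 35n]`,
`ord_p G^{(j)}(-i) ≥ -j + ν_{k',p}` with `k' = i + 27n + 1` (Lemma 17 for the polynomial bricks,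
Lemma 18 for the regularised reciprocal bricks, product rule, and the identity
`nu_eq_brickExponents`). [cite: Zudilin2004, §8 Lemma 19 (8.11)] -/
theorem G_isDOrd (n : ℕ) {p : ℕ} [hp : Fact p.Prime] (hp2 : 91 * n + 2 < p ^ 2) {i : ℕ}
    (hi : i ∈ Icc (2 * n) (35 * n)) (N : ℕ) :
    IsDOrd p (nu n (i + 27 * n + 1) p) N (G n i) (-(i : ℚ)) := by
  have hi' := mem_Icc.1 hi
  have hpt : ((-(i : ℤ) : ℤ) : ℚ) = -(i : ℚ) := by push_cast; ring
  have hpt' : (-((i : ℤ) : ℚ)) = -(i : ℚ) := by push_cast; ring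
  -- linear factor: all derivatives are integers
  have hlin : IsDOrd p 0 N (fun t : ℚ => (37 * n : ℚ) + 2 * t) (-(i : ℚ)) := by
    refine IsDOrd.of_int_derivs ((contDiffAt_const).add (contDiffAt_const.mul contDiffAt_id))
      fun j _ => ?_
    have h := iteratedDeriv_affine 2 (37 * n : ℚ) (-(i : ℚ)) j
    have hfun : (fun t : ℚ => (2 : ℚ) * t + (37 * n : ℚ)) = fun t : ℚ => (37 * n : ℚ) + 2 * t := by
      funext t; ring
    rw [hfun] at h
    rw [h]
    rcases j with _ | _ | j
    · exact ⟨37 * n - 2 * i, by push_cast; simp; ring⟩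
    · exact ⟨2, by simp⟩
    · exact ⟨0, by simp⟩
  -- polynomial bricks (Lemma 17), `27n < p²`
  have h27 : 27 * n < p ^ 2 := by omega
  have hP1 : IsDOrd p ((-((27 * n : ℕ) : ℤ) + (27 * n : ℕ) - 1 - (i : ℤ)) / p
      - (-((27 * n : ℕ) : ℤ) - 1 - (i : ℤ)) / p - ((27 * n : ℕ) : ℤ) / p) N
      (polyBrick (-(27 * n : ℕ)) (27 * n)) (-(i : ℚ)) := by
    have h := polyBrick_isDOrd p (-(27 * n : ℕ)) (27 * n) h27 (i : ℤ) N
    rwa [hpt'] at h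
  have hP2 : IsDOrd p ((((37 * n + 1 : ℕ) : ℤ) + (27 * n : ℕ) - 1 - (i : ℤ)) / p
      - (((37 * n + 1 : ℕ) : ℤ) - 1 - (i : ℤ)) / p - ((27 * n : ℕ) : ℤ) / p) N
      (polyBrick ((37 * n + 1 : ℕ)) (27 * n)) (-(i : ℚ)) := by
    have h := polyBrick_isDOrd p ((37 * n + 1 : ℕ)) (27 * n) h27 (i : ℤ) N
    rwa [hpt'] at h
  -- reciprocal bricks (Lemma 18), `a₀ = 2n`, `b₀ = 35n+1`, `33n < p²`
  have hQ : ∀ u ∈ Icc 1 10, IsDOrd p (((((13 + 2 * u) * n + 1 : ℕ) : ℤ) - 1) / p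
      - ((i : ℤ) - (((12 - u) * n : ℕ) : ℤ)) / p
      - ((((12 - u) * n : ℕ) : ℤ) + (((13 + 2 * u) * n + 1 : ℕ) : ℤ) - 1 - (i : ℤ)) / p) N
      (recipBrickReg (((12 - u) * n : ℕ)) ((13 + 2 * u) * n + 1) i) (-(i : ℚ)) := by
    intro u hu
    have hu' := mem_Icc.1 hu
    have h := recipBrickReg_isDOrd p (a₀ := (2 * n : ℤ)) (b₀ := (35 * n + 1 : ℤ))
      (a := (((12 - u) * n : ℕ) : ℤ)) (m := (13 + 2 * u) * n + 1) (k := (i : ℤ)) (by omega)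
      (by exact_mod_cast (Nat.mul_le_mul_right n (by omega : 2 ≤ 12 - u))) (by
        have : ((12 - u) * n + ((13 + 2 * u) * n + 1) : ℕ) = (25 + u) * n + 1 := by
          have h1 : (12 - u) * n + (13 + 2 * u) * n = (25 + u) * n := by
            rw [← add_mul]; congr 1; omega
          omega
        have h2 : (((12 - u) * n : ℕ) : ℤ) + ((13 + 2 * u) * n + 1 : ℕ) ≤ 35 * n + 1 := by
          rw [← Nat.cast_add, this]; push_cast; nlinarith
        exact_mod_cast h2)
      (by exact_mod_cast hi'.1) (by exact_mod_cast Nat.lt_succ_of_le hi'.2)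
      (by nlinarith) N
    rwa [hpt'] at h
  have hall := ((hlin.mul (hP1.pow 3)).mul (hP2.pow 3)).mul (IsDOrd.prod (Icc 1 10) hQ)
  rw [nu_eq_brickExponents n i p hp.out.pos]
  refine (hall.mono (le_of_eq ?_)).congr (Eventually.of_forall fun k => by simp only [G])
  push_cast
  ring

/-! ### Order of vanishing of `G n i` at `-i` -/

/-- The number of reciprocal bricks `u ∈ [1,10]` whose range `[(12-u)n, (25+u)n]` contains `i`: an
upper bound for the order of the pole of `Rₙ` at `-i` (it is AT MOST this brick count; the
polynomial bricks may cancel some of it). [cite: Zudilin2004, §8 Lemma 19 (proof)] -/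
def poleOrderBound (n i : ℕ) : ℕ :=
  ((Icc 1 10).filter fun u => (12 - u) * n ≤ i ∧ i ≤ (25 + u) * n).card

/-- `poleOrderBound n i ≤ 10`. [folklore] -/
theorem poleOrderBound_le (n i : ℕ) : poleOrderBound n i ≤ 10 := by
  unfold poleOrderBound
  exact (card_filter_le _ _).trans (by simp)

/-- If `i > (36 - s) n` (with `1 ≤ s ≤ 10`) then `poleOrderBound n i < s`: the coefficient of
`(k+i)^{-s}` can only be non-zero for `i ≤ (36-s)n` ([Fischler2004, §3.3]: `i ≤ (36-j)n`).
[cite: Fischler2004, §3.3] -/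
theorem poleOrderBound_lt_of_lt {n i s : ℕ} (hs : 1 ≤ s) (hs' : s ≤ 10) (h : (36 - s) * n < i) :
    poleOrderBound n i < s := by
  unfold poleOrderBound
  have hsub : ((Icc 1 10).filter fun u => (12 - u) * n ≤ i ∧ i ≤ (25 + u) * n) ⊆ Icc (12 - s) 10 := by
    intro u hu
    have hu' := mem_filter.1 hu
    have hu1 := mem_Icc.1 hu'.1
    refine mem_Icc.2 ⟨?_, hu1.2⟩
    by_contra hlt
    push Not at hlt
    have : (25 + u) * n ≤ (36 - s) * n := Nat.mul_le_mul_right _ (by omega)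
    omega
  refine (card_le_card hsub).trans_lt ?_
  rw [Nat.card_Icc]
  omega

/-- `G n i` has a zero of order `≥ 10 - poleOrderBound n i` at `-i`: it is `(k + i)^{10 - b} · g(k)` with
`g` smooth at `-i`. [cite: Zudilin2004, §8 Lemma 19 (proof)] -/
theorem G_eq_pow_mul (n i : ℕ) : ∃ g : ℚ → ℚ, ContDiffAt ℚ (⊤ : ℕ∞) g (-(i : ℚ)) ∧
    ∀ k : ℚ, G n i k = (k - (-(i : ℚ))) ^ (10 - poleOrderBound n i) * g k := by
  classical
  set g : ℚ → ℚ := fun k => (37 * n + 2 * k) * polyBrick (-(27 * n : ℕ)) (27 * n) k ^ 3 *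
    polyBrick ((37 * n + 1 : ℕ)) (27 * n) k ^ 3 *
    ∏ u ∈ Icc 1 10, ((((13 + 2 * u) * n + 1 - 1)! : ℚ) *
      ∏ l ∈ (range ((13 + 2 * u) * n + 1)).filter (fun l : ℕ => (((12 - u) * n : ℕ) : ℤ) + (l : ℤ) ≠ i),
        (k + ((((((12 - u) * n : ℕ) : ℤ)) + (l : ℤ) : ℤ) : ℚ))⁻¹) with hg
  refine ⟨g, ?_, fun k => ?_⟩
  · -- smoothness at `-i`
    have hpoly : ∀ (b : ℤ) (m : ℕ), ContDiffAt ℚ (⊤ : ℕ∞) (polyBrick b m) (-(i : ℚ)) := by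
      intro b m
      have : polyBrick b m = fun t : ℚ => (∏ l ∈ range m, (t + (b : ℚ) + (l : ℚ))) / (m ! : ℚ) := rfl
      rw [this]
      exact (contDiffAt_prod fun l _ => (contDiffAt_id.add contDiffAt_const).add contDiffAt_const).div_const _
    refine ((((contDiffAt_const).add (contDiffAt_const.mul contDiffAt_id)).mul
      ((hpoly _ _).pow 3)).mul ((hpoly _ _).pow 3)).mul (contDiffAt_prod fun u hu => ?_)
    refine contDiffAt_const.mul (contDiffAt_prod fun l hl => ?_)
    have hl' := (mem_filter.1 hl).2
    refine contDiffAt_inv_add_const ?_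
    rw [show (-(i : ℚ) + (((((12 - u) * n : ℕ) : ℤ) + (l : ℤ) : ℤ) : ℚ))
      = (((((12 - u) * n : ℕ) : ℤ) + (l : ℤ) - i : ℤ) : ℚ) by push_cast; ring]
    exact_mod_cast sub_ne_zero.2 hl'
  · -- the factorisation
    have hprod : ∏ u ∈ Icc 1 10, recipBrickReg (((12 - u) * n : ℕ)) ((13 + 2 * u) * n + 1) i k
        = (∏ u ∈ Icc 1 10, ((((13 + 2 * u) * n + 1 - 1)! : ℚ) *
            ∏ l ∈ (range ((13 + 2 * u) * n + 1)).filter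
              (fun l : ℕ => (((12 - u) * n : ℕ) : ℤ) + (l : ℤ) ≠ i),
              (k + ((((((12 - u) * n : ℕ) : ℤ)) + (l : ℤ) : ℤ) : ℚ))⁻¹))
          * ∏ u ∈ Icc 1 10, (if (((12 - u) * n : ℕ) : ℤ) ≤ i ∧ (i : ℤ) < (((12 - u) * n : ℕ) : ℤ)
              + ((13 + 2 * u) * n + 1 : ℕ) then (1 : ℚ) else (k + i)) := by
      rw [← prod_mul_distrib]
      rfl
    have hite : ∏ u ∈ Icc 1 10, (if (((12 - u) * n : ℕ) : ℤ) ≤ i ∧ (i : ℤ) < (((12 - u) * n : ℕ) : ℤ)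
        + ((13 + 2 * u) * n + 1 : ℕ) then (1 : ℚ) else (k + i)) = (k - (-(i : ℚ))) ^ (10 - poleOrderBound n i) := by
      rw [prod_ite, prod_const_one, one_mul, prod_const]
      congr 1
      · ring
      · unfold poleOrderBound
        have hc : ((Icc 1 10).filter fun u => ¬((((12 - u) * n : ℕ) : ℤ) ≤ i ∧
            (i : ℤ) < (((12 - u) * n : ℕ) : ℤ) + ((13 + 2 * u) * n + 1 : ℕ))).card
            + ((Icc 1 10).filter fun u => (12 - u) * n ≤ i ∧ i ≤ (25 + u) * n).card = 10 := by
          have h1 := Finset.card_filter_add_card_filter_not (s := Icc 1 10)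
            (p := fun u => (12 - u) * n ≤ i ∧ i ≤ (25 + u) * n)
          rw [Nat.card_Icc] at h1
          have h2 : ((Icc 1 10).filter fun u => ¬((((12 - u) * n : ℕ) : ℤ) ≤ i ∧
              (i : ℤ) < (((12 - u) * n : ℕ) : ℤ) + ((13 + 2 * u) * n + 1 : ℕ)))
              = (Icc 1 10).filter fun u => ¬((12 - u) * n ≤ i ∧ i ≤ (25 + u) * n) := by
            refine filter_congr fun u hu => ?_
            have hu' := mem_Icc.1 hu
            have e : (12 - u) * n + ((13 + 2 * u) * n + 1) = (25 + u) * n + 1 := by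
              have : (12 - u) * n + (13 + 2 * u) * n = (25 + u) * n := by
                rw [← add_mul]; congr 1; omega
              omega
            rw [← Nat.cast_add, e]
            push_cast
            constructor
            · rintro h ⟨h1, h2⟩; exact h ⟨by exact_mod_cast h1, by exact_mod_cast Nat.lt_succ_of_le h2⟩
            · rintro h ⟨h1, h2⟩; exact h ⟨by exact_mod_cast h1, Nat.le_of_lt_succ (by exact_mod_cast h2)⟩
          rw [h2]
          omega
        omega
    rw [G, hprod, hite, hg]
    ring

/-- **Vanishing of low divided derivatives**: `(1/a!) G^{(a)}(-i) = 0` for `a < 10 - poleOrderBound n i`.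
[cite: Zudilin2004, §8 Lemma 19 (proof)] -/
theorem divDeriv_G_eq_zero (n i : ℕ) {a : ℕ} (ha : a < 10 - poleOrderBound n i) :
    divDeriv a (G n i) (-(i : ℚ)) = 0 := by
  obtain ⟨g, hg, hG⟩ := G_eq_pow_mul n i
  have hfun : G n i = fun k => (k - (-(i : ℚ))) ^ (10 - poleOrderBound n i) * g k := funext hG
  rw [hfun, divDeriv_sub_pow_mul (hg.of_le (mod_cast le_top)) (10 - poleOrderBound n i), if_pos ha]

end Zudilin2004

end Literature.NumberTheory.Transcendental
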